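import Mathlib
import Summits.NavierStokesRegularity.FluidComputer.TransportGalerkinEmergenceLevels
import Summits.NavierStokesRegularity.FluidComputer.TransportGalerkinAbcShift
import HarnessLib

/-!
# Galerkin limit of the transport model, XII: the forced-ABC KEEP from a certified eigenvalue, RESIDENCE-FREE (instab g19, cell `ns-blowup`, 2026-08-27)

HONEST FRAMING (human ruling D-0035): nothing here is a claim about Navier–Stokes blow-up.
WHAT THIS IS NOT: not NS — a MODEL theorem schema about the forced-ABC perturbation equation on
`𝕋³` (`nsField ν (𝓕 abc) proj lerayCLM` on the scaled phase space `E = lp (ℤ³ → ℂ³) 2`), whose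
load-bearing inputs are the Lyapunov certificates of record and the certified X0 eigenvalue; no number
or census word moves.

PURPOSE. g18's `TransportGalerkinAbcShift.exists_keep_eigenvector_abc_shift` reads KEEP for the
forced-ABC model from a certified real eigenvalue PLUS radii/box/residence inputs (β3). Part XI
(`TransportGalerkinEmergenceH2.half_prediction_nsField_of_levelBound`) removed residence for a
general host; this file is the ABC instance (`exists_keep_eigenvector_abc_of_levelBound`): from
`Torus.IsLinNSEigenvalue ν (abcFlow A B C) μ` (`μ ≥ 0`, `ν > 0`) the X0 door
(`TransportGalerkinAbcEigen.exists_eigenData_of_isLinNSEigenvalue_abc`) returns the unit, rapidly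
decreasing, Leray-fixed, real, divergence-free eigenvector `v` with `hres`, and KEEP holds for every
choice of the REMAINING inputs: the Galerkin levels of `ε•v` (existence on `[0, T]` as solutions of
the finite-dimensional ODE in `range P_{n+K}`, the three linear invariants, ONE `H²` bound `r` — the
bootstrap's own), the certificate objects and inequalities at levels `≥ K`, the gap `ω < 2μ`, margin
and window, and a true solution `w` from `ε•v` with a uniform polynomial tail of scaled order `6` and
the clauses. `σ₂² < ∞` is discharged on `ℤ³` (`ConvectiveProductLawBooking.tsum_sobolevWeight_neg_two_sq_lt_top`).
Second form (`exists_keep_eigenvector_abc_of_levels`, via part XIII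
`TransportGalerkinEmergenceLevels.half_prediction_nsField_of_levels`): the `H²` bound is dropped too
(the chain's own ceiling at all large levels + continuity at the finitely many others); the levels
enter only as `C¹` solutions of the finite-dimensional Galerkin ODE keeping the linear clauses.
KERNEL STATE for the model of record: certificates + X0 row + (finite-dimensional ODE existence and
linear invariants) ⇒ KEEP. No computer-assisted integration anywhere.
-/

noncomputable section

open scoped ENNReal NNReal ComplexConjugate InnerProductSpace
open Set Filter Topology

namespace Summit.NavierStokesRegularity.FluidComputer.TransportGalerkinAbcH2

open RCLike MeasureTheory UnitAddTorus
open Literature.Analysis.FunctionSpaces Literature.Analysis.FunctionSpaces.Lattice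
open Literature.Analysis.FunctionSpaces.Torus Literature.Analysis.FunctionSpaces.EuclideanSpace
open Literature.Analysis.ODE Literature.Analysis.FluidPDE
open Summit.NavierStokesRegularity.FluidComputer.TransportGalerkin
open Summit.NavierStokesRegularity.FluidComputer.TransportGalerkinAbc
open Summit.NavierStokesRegularity.FluidComputer.TransportGalerkinAbcEigen
open Summit.NavierStokesRegularity.FluidComputer.TransportGalerkinEmergenceH2
open Summit.NavierStokesRegularity.FluidComputer.TransportGalerkinEmergenceLevels
open Summit.NavierStokesRegularity.FluidComputer.ConvectiveProductLawBooking

/-- **KEEP for the forced-ABC model from a certified real eigenvalue, with RESIDENCE replaced by the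
bootstrap's `H²` bound** (levels `cubeProj (n + K)`; see the module docstring for the list of
remaining inputs). -/
theorem exists_keep_eigenvector_abc_of_levelBound (K : ℕ) (A B C : ℝ) {ν μ : ℝ} (hν : 0 < ν) (hμ : 0 ≤ μ)
    (heig : Torus.IsLinNSEigenvalue ν (Torus.abcFlow A B C) (μ : ℂ)) :
    ∃ v : lp (fun _ : (Fin 3 → ℤ) => EuclideanSpace ℂ (Fin 3)) 2,
      ‖v‖ = 1 ∧ RapidDecay (⇑v) ∧ (∀ k, lerayCLM k (v k) = v k) ∧
      (∀ (j : Fin 3) (k : Fin 3 → ℤ), (EuclideanSpace.proj j : EuclideanSpace ℂ (Fin 3) →L[ℂ] ℂ) (v (-k)) =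
        conj ((EuclideanSpace.proj j : EuclideanSpace ℂ (Fin 3) →L[ℂ] ℂ) (v k))) ∧
      (∀ k : Fin 3 → ℤ, ∑ j, ((k j : ℤ) : ℂ) * (EuclideanSpace.proj j : EuclideanSpace ℂ (Fin 3) →L[ℂ] ℂ) (v k) = 0) ∧
      linOp ν (mFourierCoeff (complexify ∘ Torus.abcFlow A B C))
          (fun j => (EuclideanSpace.proj j : EuclideanSpace ℂ (Fin 3) →L[ℂ] ℂ)) lerayCLM v = μ • v ∧
      ∀ {T : ℝ} (hT : 0 ≤ T) {ε : ℝ} (hε : 0 < ε)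
        -- the Galerkin levels of `ε • v`: existence, linear invariants, the `H²` bound
        {u : ℕ → ℝ → lp (fun _ : (Fin 3 → ℤ) => EuclideanSpace ℂ (Fin 3)) 2} {r : ℝ} (hr : 0 < r)
        (sol_continuousOn : ∀ n, ContinuousOn (u n) (Icc 0 T))
        (sol_init : ∀ n, u n 0 = cubeProj (n + K) (ε • v))
        (sol_hasDerivWithinAt : ∀ n, ∀ t ∈ Icc 0 T,
          HasDerivWithinAt (u n) (cubeProj (n + K) (nsField ν (mFourierCoeff (EuclideanSpace.complexify ∘ Torus.abcFlow A B C))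
            (fun j => (EuclideanSpace.proj j : EuclideanSpace ℂ (Fin 3) →L[ℂ] ℂ)) lerayCLM (u n t))) (Icc 0 T) t)
        (sol_proj : ∀ n, ∀ t ∈ Icc 0 T, cubeProj (n + K) (u n t) = u n t)
        (sol_fix : ∀ n, ∀ t ∈ Icc 0 T, ∀ k, lerayCLM k ((u n t : (Fin 3 → ℤ) → EuclideanSpace ℂ (Fin 3)) k) =
          (u n t : (Fin 3 → ℤ) → EuclideanSpace ℂ (Fin 3)) k)
        (sol_real : ∀ n, ∀ t ∈ Icc 0 T, ∀ (j : Fin 3) (k : Fin 3 → ℤ),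
          (EuclideanSpace.proj j : EuclideanSpace ℂ (Fin 3) →L[ℂ] ℂ) ((u n t : (Fin 3 → ℤ) → EuclideanSpace ℂ (Fin 3)) (-k)) =
            conj ((EuclideanSpace.proj j : EuclideanSpace ℂ (Fin 3) →L[ℂ] ℂ) ((u n t : (Fin 3 → ℤ) → EuclideanSpace ℂ (Fin 3)) k)))
        (sol_div : ∀ n, ∀ t ∈ Icc 0 T, ∀ k : Fin 3 → ℤ,
          ∑ j, ((k j : ℤ) : ℂ) * (EuclideanSpace.proj j : EuclideanSpace ℂ (Fin 3) →L[ℂ] ℂ)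
            ((u n t : (Fin 3 → ℤ) → EuclideanSpace ℂ (Fin 3)) k) = 0)
        (sol_bound : ∀ n, ∀ t ∈ Icc 0 T, ‖u n t‖ ≤ r)
        -- the certificates (verbatim g18)
        {μt : ℝ}
        {G₁ G₂ G : lp (fun _ : (Fin 3 → ℤ) => EuclideanSpace ℂ (Fin 3)) 2 →L[ℝ]
          lp (fun _ : (Fin 3 → ℤ) => EuclideanSpace ℂ (Fin 3)) 2}
        (hG₁ : ∀ x y : lp (fun _ : (Fin 3 → ℤ) => EuclideanSpace ℂ (Fin 3)) 2, ⟪G₁ x, y⟫_ℂ = ⟪x, G₁ y⟫_ℂ)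
        (hG₂ : ∀ x y : lp (fun _ : (Fin 3 → ℤ) => EuclideanSpace ℂ (Fin 3)) 2, ⟪G₂ x, y⟫_ℂ = ⟪x, G₂ y⟫_ℂ)
        (hG : ∀ x y : lp (fun _ : (Fin 3 → ℤ) => EuclideanSpace ℂ (Fin 3)) 2, ⟪G x, y⟫_ℂ = ⟪x, G y⟫_ℂ)
        (hG₁P : ∀ n, ∀ w z : lp (fun _ : (Fin 3 → ℤ) => EuclideanSpace ℂ (Fin 3)) 2,
          ⟪G₁ w, cubeProj (n + K) z⟫_ℂ = ⟪G₁ (cubeProj (n + K) w), z⟫_ℂ)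
        (hG₂P : ∀ n, ∀ w z : lp (fun _ : (Fin 3 → ℤ) => EuclideanSpace ℂ (Fin 3)) 2,
          ⟪G₂ w, cubeProj (n + K) z⟫_ℂ = ⟪G₂ (cubeProj (n + K) w), z⟫_ℂ)
        (hGP : ∀ n, ∀ w z : lp (fun _ : (Fin 3 → ℤ) => EuclideanSpace ℂ (Fin 3)) 2,
          ⟪G w, cubeProj (n + K) z⟫_ℂ = ⟪G (cubeProj (n + K) w), z⟫_ℂ)
        (hG₁pos : ∀ x : lp (fun _ : (Fin 3 → ℤ) => EuclideanSpace ℂ (Fin 3)) 2, 0 ≤ re ⟪G₁ x, x⟫_ℂ)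
        {ω c m₂ M₁ : ℝ} (hc : 0 < c) (hm₂ : 0 < m₂) (hM₁ : 0 ≤ M₁)
        (hm₂' : ∀ x : lp (fun _ : (Fin 3 → ℤ) => EuclideanSpace ℂ (Fin 3)) 2, m₂ * ‖x‖ ^ 2 ≤ re ⟪G₂ x, x⟫_ℂ)
        (hM₁' : ∀ x : lp (fun _ : (Fin 3 → ℤ) => EuclideanSpace ℂ (Fin 3)) 2,
          re ⟪G₁ x, x⟫_ℂ ≤ M₁ * (eNormSq (-1) (⇑x)).toReal)
        {m M ω₁ : ℝ} (hm0 : 0 < m)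
        (hm : ∀ x : lp (fun _ : (Fin 3 → ℤ) => EuclideanSpace ℂ (Fin 3)) 2, m * ‖x‖ ^ 2 ≤ re ⟪G x, x⟫_ℂ)
        (hM : ∀ x : lp (fun _ : (Fin 3 → ℤ) => EuclideanSpace ℂ (Fin 3)) 2, re ⟪G x, x⟫_ℂ ≤ M * ‖x‖ ^ 2)
        (h₁ : ∀ n, ∀ w : lp (fun _ : (Fin 3 → ℤ) => EuclideanSpace ℂ (Fin 3)) 2,
          2 * re ⟪G₁ (cubeProj (n + K) w), linOp ν (mFourierCoeff (EuclideanSpace.complexify ∘ Torus.abcFlow A B C))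
            (fun j => (EuclideanSpace.proj j : EuclideanSpace ℂ (Fin 3) →L[ℂ] ℂ)) lerayCLM (cubeProj (n + K) w)⟫_ℂ +
            c * re ⟪G₂ (cubeProj (n + K) w), cubeProj (n + K) w⟫_ℂ ≤ 2 * ω * re ⟪G₁ (cubeProj (n + K) w), cubeProj (n + K) w⟫_ℂ)
        (h₂ : ∀ n, ∀ w : lp (fun _ : (Fin 3 → ℤ) => EuclideanSpace ℂ (Fin 3)) 2,
          re ⟪G₂ (cubeProj (n + K) w), linOp ν (mFourierCoeff (EuclideanSpace.complexify ∘ Torus.abcFlow A B C))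
            (fun j => (EuclideanSpace.proj j : EuclideanSpace ℂ (Fin 3) →L[ℂ] ℂ)) lerayCLM (cubeProj (n + K) w)⟫_ℂ ≤
            ω * re ⟪G₂ (cubeProj (n + K) w), cubeProj (n + K) w⟫_ℂ)
        (hL : ∀ n, ∀ w : lp (fun _ : (Fin 3 → ℤ) => EuclideanSpace ℂ (Fin 3)) 2,
          re ⟪G (cubeProj (n + K) w), linOp ν (mFourierCoeff (EuclideanSpace.complexify ∘ Torus.abcFlow A B C))
            (fun j => (EuclideanSpace.proj j : EuclideanSpace ℂ (Fin 3) →L[ℂ] ℂ)) lerayCLM (cubeProj (n + K) w)⟫_ℂ ≤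
            ω₁ * re ⟪G (cubeProj (n + K) w), cubeProj (n + K) w⟫_ℂ)
        (hμ₁ : μt ≤ ω₁) (hμ₂ : μt ≤ ω)
        (htail : ∀ n, ∀ q : lp (fun _ : (Fin 3 → ℤ) => EuclideanSpace ℂ (Fin 3)) 2, cubeProj (n + K) q = 0 →
          2 * μt * re ⟪G₁ q, q⟫_ℂ + c * re ⟪G₂ q, q⟫_ℂ ≤ 2 * ω * re ⟪G₁ q, q⟫_ℂ)
        (hgap : ω < 2 * μ)
        {C' : ℝ}
        (hCC' : Real.sqrt (M₁ / (c * m₂)) * (2 * ((Fintype.card (Fin 3) : ℝ) * (2 * Real.pi)) *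
            Real.sqrt ((∑' l : Fin 3 → ℤ, ENNReal.ofReal (sobolevWeight (-2) l ^ 2)).toReal)) *
            Real.sqrt (Real.pi / (2 * μ - ω)) < C')
        (hsmall : ∀ t ∈ Icc 0 T, C' * (3 / 2 : ℝ) ^ 2 * (ε * Real.exp (μ * t)) < 3 / 2 - 1)
        -- the true solution, in the class with a uniform polynomial tail of scaled order 6
        {w : ℝ → lp (fun _ : (Fin 3 → ℤ) => EuclideanSpace ℂ (Fin 3)) 2} (hw : ContinuousOn w (Icc 0 T))
        (hw0 : w 0 = ε • v)
        (hw' : ∀ t ∈ Ioo 0 T, HasDerivAt w (nsField ν (mFourierCoeff (EuclideanSpace.complexify ∘ Torus.abcFlow A B C))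
          (fun j => (EuclideanSpace.proj j : EuclideanSpace ℂ (Fin 3) →L[ℂ] ℂ)) lerayCLM (w t)) t)
        {Cw : ℝ} (hCw : 0 ≤ Cw)
        (hwdec : ∀ t ∈ Icc 0 T, ∀ k, ‖(w t : (Fin 3 → ℤ) → EuclideanSpace ℂ (Fin 3)) k‖ ≤
          Cw * sobolevWeight (-((Fintype.card (Fin 3) : ℝ) + 3)) k)
        (hwfix : ∀ t ∈ Icc 0 T, ∀ k, lerayCLM k ((w t : (Fin 3 → ℤ) → EuclideanSpace ℂ (Fin 3)) k) =
          (w t : (Fin 3 → ℤ) → EuclideanSpace ℂ (Fin 3)) k)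
        (hwreal : ∀ t ∈ Icc 0 T, ∀ (j : Fin 3) (k : Fin 3 → ℤ),
          (EuclideanSpace.proj j : EuclideanSpace ℂ (Fin 3) →L[ℂ] ℂ) ((w t : (Fin 3 → ℤ) → EuclideanSpace ℂ (Fin 3)) (-k)) =
            conj ((EuclideanSpace.proj j : EuclideanSpace ℂ (Fin 3) →L[ℂ] ℂ) ((w t : (Fin 3 → ℤ) → EuclideanSpace ℂ (Fin 3)) k)))
        (hwdiv : ∀ t ∈ Icc 0 T, ∀ k : Fin 3 → ℤ,
          ∑ j, ((k j : ℤ) : ℂ) * (EuclideanSpace.proj j : EuclideanSpace ℂ (Fin 3) →L[ℂ] ℂ)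
            ((w t : (Fin 3 → ℤ) → EuclideanSpace ℂ (Fin 3)) k) = 0)
        {t : ℝ} (ht : t ∈ Icc 0 T) (hχ : ε * Real.exp (μ * t) ≤ 2 / (9 * C')),
        ε * Real.exp (μ * t) / 2 ≤ ‖w t‖ := by
  obtain ⟨v, hv1, hvr, hvP, hvreal, hvdiv, hAv, hres⟩ := exists_eigenData_of_isLinNSEigenvalue_abc A B C heig
  refine ⟨v, hv1, hvr, hvP, hvreal, hvdiv, hAv, ?_⟩
  intro T hT ε hε u r hr sol_continuousOn sol_init sol_hasDerivWithinAt sol_proj sol_fix sol_real sol_div sol_bound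
    μt G₁ G₂ G hG₁ hG₂ hG hG₁P hG₂P hGP hG₁pos ω c m₂ M₁ hc hm₂ hM₁ hm₂' hM₁' m M ω₁ hm0 hm hM h₁ h₂ hL hμ₁ hμ₂
    htail hgap C' hCC' hsmall w hw hw0 hw' Cw hCw hwdec hwfix hwreal hwdiv t ht hχ
  exact half_prediction_nsField_of_levelBound K hν (rapidDecay_abcHost A B C) (abcHost_real A B C)
    (abcHost_div A B C) norm_proj_le isSelfAdjoint_lerayCLM norm_lerayCLM_le
    (tsum_sobolevWeight_neg_two_sq_lt_top (Fintype.card_fin 3).le) hT hv1 hvr hvP hvreal hvdiv hμ hε hr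
    sol_continuousOn sol_init sol_hasDerivWithinAt sol_proj sol_fix sol_real sol_div sol_bound hG₁ hG₂ hG hG₁P
    hG₂P hGP hG₁pos hc hm₂ hM₁ hm₂' hM₁' hm0 hm hM h₁ h₂ hL hμ₁ hμ₂ htail hgap
    (hres.comp (tendsto_add_atTop_nat K)) hCC' hsmall hw hw0 hw' hCw hwdec hwfix hwreal hwdiv ht hχ

/-- **KEEP for the forced-ABC model from a certified real eigenvalue, residence AND the `H²` bound
supplied by the chain** (levels `cubeProj (n + K)`; the levels enter only as `C¹` solutions of the
finite-dimensional Galerkin ODE keeping the linear clauses). -/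
theorem exists_keep_eigenvector_abc_of_levels (K : ℕ) (A B C : ℝ) {ν μ : ℝ} (hν : 0 < ν) (hμ : 0 ≤ μ)
    (heig : Torus.IsLinNSEigenvalue ν (Torus.abcFlow A B C) (μ : ℂ)) :
    ∃ v : lp (fun _ : (Fin 3 → ℤ) => EuclideanSpace ℂ (Fin 3)) 2,
      ‖v‖ = 1 ∧ RapidDecay (⇑v) ∧ (∀ k, lerayCLM k (v k) = v k) ∧
      (∀ (j : Fin 3) (k : Fin 3 → ℤ), (EuclideanSpace.proj j : EuclideanSpace ℂ (Fin 3) →L[ℂ] ℂ) (v (-k)) =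
        conj ((EuclideanSpace.proj j : EuclideanSpace ℂ (Fin 3) →L[ℂ] ℂ) (v k))) ∧
      (∀ k : Fin 3 → ℤ, ∑ j, ((k j : ℤ) : ℂ) * (EuclideanSpace.proj j : EuclideanSpace ℂ (Fin 3) →L[ℂ] ℂ) (v k) = 0) ∧
      linOp ν (mFourierCoeff (complexify ∘ Torus.abcFlow A B C))
          (fun j => (EuclideanSpace.proj j : EuclideanSpace ℂ (Fin 3) →L[ℂ] ℂ)) lerayCLM v = μ • v ∧
      ∀ {T : ℝ} (hT : 0 ≤ T) {ε : ℝ} (hε : 0 < ε)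
        -- the Galerkin levels of `ε • v`: `C¹` solutions keeping the linear clauses
        {u : ℕ → ℝ → lp (fun _ : (Fin 3 → ℤ) => EuclideanSpace ℂ (Fin 3)) 2}
        (sol_continuousOn : ∀ n, ContinuousOn (u n) (Icc 0 T))
        (sol_init : ∀ n, u n 0 = cubeProj (n + K) (ε • v))
        (sol_hasDerivWithinAt : ∀ n, ∀ t ∈ Icc 0 T,
          HasDerivWithinAt (u n) (cubeProj (n + K) (nsField ν (mFourierCoeff (EuclideanSpace.complexify ∘ Torus.abcFlow A B C))
            (fun j => (EuclideanSpace.proj j : EuclideanSpace ℂ (Fin 3) →L[ℂ] ℂ)) lerayCLM (u n t))) (Icc 0 T) t)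
        (sol_derivCont : ∀ n, ContinuousOn (fun t => cubeProj (n + K) (nsField ν
            (mFourierCoeff (EuclideanSpace.complexify ∘ Torus.abcFlow A B C))
            (fun j => (EuclideanSpace.proj j : EuclideanSpace ℂ (Fin 3) →L[ℂ] ℂ)) lerayCLM (u n t))) (Icc 0 T))
        (sol_proj : ∀ n, ∀ t ∈ Icc 0 T, cubeProj (n + K) (u n t) = u n t)
        (sol_fix : ∀ n, ∀ t ∈ Icc 0 T, ∀ k, lerayCLM k ((u n t : (Fin 3 → ℤ) → EuclideanSpace ℂ (Fin 3)) k) =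
          (u n t : (Fin 3 → ℤ) → EuclideanSpace ℂ (Fin 3)) k)
        (sol_real : ∀ n, ∀ t ∈ Icc 0 T, ∀ (j : Fin 3) (k : Fin 3 → ℤ),
          (EuclideanSpace.proj j : EuclideanSpace ℂ (Fin 3) →L[ℂ] ℂ) ((u n t : (Fin 3 → ℤ) → EuclideanSpace ℂ (Fin 3)) (-k)) =
            conj ((EuclideanSpace.proj j : EuclideanSpace ℂ (Fin 3) →L[ℂ] ℂ) ((u n t : (Fin 3 → ℤ) → EuclideanSpace ℂ (Fin 3)) k)))
        (sol_div : ∀ n, ∀ t ∈ Icc 0 T, ∀ k : Fin 3 → ℤ,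
          ∑ j, ((k j : ℤ) : ℂ) * (EuclideanSpace.proj j : EuclideanSpace ℂ (Fin 3) →L[ℂ] ℂ)
            ((u n t : (Fin 3 → ℤ) → EuclideanSpace ℂ (Fin 3)) k) = 0)
        -- the certificates (verbatim g18)
        {μt : ℝ}
        {G₁ G₂ G : lp (fun _ : (Fin 3 → ℤ) => EuclideanSpace ℂ (Fin 3)) 2 →L[ℝ]
          lp (fun _ : (Fin 3 → ℤ) => EuclideanSpace ℂ (Fin 3)) 2}
        (hG₁ : ∀ x y : lp (fun _ : (Fin 3 → ℤ) => EuclideanSpace ℂ (Fin 3)) 2, ⟪G₁ x, y⟫_ℂ = ⟪x, G₁ y⟫_ℂ)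
        (hG₂ : ∀ x y : lp (fun _ : (Fin 3 → ℤ) => EuclideanSpace ℂ (Fin 3)) 2, ⟪G₂ x, y⟫_ℂ = ⟪x, G₂ y⟫_ℂ)
        (hG : ∀ x y : lp (fun _ : (Fin 3 → ℤ) => EuclideanSpace ℂ (Fin 3)) 2, ⟪G x, y⟫_ℂ = ⟪x, G y⟫_ℂ)
        (hG₁P : ∀ n, ∀ w z : lp (fun _ : (Fin 3 → ℤ) => EuclideanSpace ℂ (Fin 3)) 2,
          ⟪G₁ w, cubeProj (n + K) z⟫_ℂ = ⟪G₁ (cubeProj (n + K) w), z⟫_ℂ)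
        (hG₂P : ∀ n, ∀ w z : lp (fun _ : (Fin 3 → ℤ) => EuclideanSpace ℂ (Fin 3)) 2,
          ⟪G₂ w, cubeProj (n + K) z⟫_ℂ = ⟪G₂ (cubeProj (n + K) w), z⟫_ℂ)
        (hGP : ∀ n, ∀ w z : lp (fun _ : (Fin 3 → ℤ) => EuclideanSpace ℂ (Fin 3)) 2,
          ⟪G w, cubeProj (n + K) z⟫_ℂ = ⟪G (cubeProj (n + K) w), z⟫_ℂ)
        (hG₁pos : ∀ x : lp (fun _ : (Fin 3 → ℤ) => EuclideanSpace ℂ (Fin 3)) 2, 0 ≤ re ⟪G₁ x, x⟫_ℂ)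
        {ω c m₂ M₁ : ℝ} (hc : 0 < c) (hm₂ : 0 < m₂) (hM₁ : 0 ≤ M₁)
        (hm₂' : ∀ x : lp (fun _ : (Fin 3 → ℤ) => EuclideanSpace ℂ (Fin 3)) 2, m₂ * ‖x‖ ^ 2 ≤ re ⟪G₂ x, x⟫_ℂ)
        (hM₁' : ∀ x : lp (fun _ : (Fin 3 → ℤ) => EuclideanSpace ℂ (Fin 3)) 2,
          re ⟪G₁ x, x⟫_ℂ ≤ M₁ * (eNormSq (-1) (⇑x)).toReal)
        {m M ω₁ : ℝ} (hm0 : 0 < m)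
        (hm : ∀ x : lp (fun _ : (Fin 3 → ℤ) => EuclideanSpace ℂ (Fin 3)) 2, m * ‖x‖ ^ 2 ≤ re ⟪G x, x⟫_ℂ)
        (hM : ∀ x : lp (fun _ : (Fin 3 → ℤ) => EuclideanSpace ℂ (Fin 3)) 2, re ⟪G x, x⟫_ℂ ≤ M * ‖x‖ ^ 2)
        (h₁ : ∀ n, ∀ w : lp (fun _ : (Fin 3 → ℤ) => EuclideanSpace ℂ (Fin 3)) 2,
          2 * re ⟪G₁ (cubeProj (n + K) w), linOp ν (mFourierCoeff (EuclideanSpace.complexify ∘ Torus.abcFlow A B C))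
            (fun j => (EuclideanSpace.proj j : EuclideanSpace ℂ (Fin 3) →L[ℂ] ℂ)) lerayCLM (cubeProj (n + K) w)⟫_ℂ +
            c * re ⟪G₂ (cubeProj (n + K) w), cubeProj (n + K) w⟫_ℂ ≤ 2 * ω * re ⟪G₁ (cubeProj (n + K) w), cubeProj (n + K) w⟫_ℂ)
        (h₂ : ∀ n, ∀ w : lp (fun _ : (Fin 3 → ℤ) => EuclideanSpace ℂ (Fin 3)) 2,
          re ⟪G₂ (cubeProj (n + K) w), linOp ν (mFourierCoeff (EuclideanSpace.complexify ∘ Torus.abcFlow A B C))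
            (fun j => (EuclideanSpace.proj j : EuclideanSpace ℂ (Fin 3) →L[ℂ] ℂ)) lerayCLM (cubeProj (n + K) w)⟫_ℂ ≤
            ω * re ⟪G₂ (cubeProj (n + K) w), cubeProj (n + K) w⟫_ℂ)
        (hL : ∀ n, ∀ w : lp (fun _ : (Fin 3 → ℤ) => EuclideanSpace ℂ (Fin 3)) 2,
          re ⟪G (cubeProj (n + K) w), linOp ν (mFourierCoeff (EuclideanSpace.complexify ∘ Torus.abcFlow A B C))
            (fun j => (EuclideanSpace.proj j : EuclideanSpace ℂ (Fin 3) →L[ℂ] ℂ)) lerayCLM (cubeProj (n + K) w)⟫_ℂ ≤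
            ω₁ * re ⟪G (cubeProj (n + K) w), cubeProj (n + K) w⟫_ℂ)
        (hμ₁ : μt ≤ ω₁) (hμ₂ : μt ≤ ω)
        (htail : ∀ n, ∀ q : lp (fun _ : (Fin 3 → ℤ) => EuclideanSpace ℂ (Fin 3)) 2, cubeProj (n + K) q = 0 →
          2 * μt * re ⟪G₁ q, q⟫_ℂ + c * re ⟪G₂ q, q⟫_ℂ ≤ 2 * ω * re ⟪G₁ q, q⟫_ℂ)
        (hgap : ω < 2 * μ)
        {C' : ℝ}
        (hCC' : Real.sqrt (M₁ / (c * m₂)) * (2 * ((Fintype.card (Fin 3) : ℝ) * (2 * Real.pi)) *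
            Real.sqrt ((∑' l : Fin 3 → ℤ, ENNReal.ofReal (sobolevWeight (-2) l ^ 2)).toReal)) *
            Real.sqrt (Real.pi / (2 * μ - ω)) < C')
        (hsmall : ∀ t ∈ Icc 0 T, C' * (3 / 2 : ℝ) ^ 2 * (ε * Real.exp (μ * t)) < 3 / 2 - 1)
        -- the true solution, in the class with a uniform polynomial tail of scaled order 6
        {w : ℝ → lp (fun _ : (Fin 3 → ℤ) => EuclideanSpace ℂ (Fin 3)) 2} (hw : ContinuousOn w (Icc 0 T))
        (hw0 : w 0 = ε • v)
        (hw' : ∀ t ∈ Ioo 0 T, HasDerivAt w (nsField ν (mFourierCoeff (EuclideanSpace.complexify ∘ Torus.abcFlow A B C))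
          (fun j => (EuclideanSpace.proj j : EuclideanSpace ℂ (Fin 3) →L[ℂ] ℂ)) lerayCLM (w t)) t)
        {Cw : ℝ} (hCw : 0 ≤ Cw)
        (hwdec : ∀ t ∈ Icc 0 T, ∀ k, ‖(w t : (Fin 3 → ℤ) → EuclideanSpace ℂ (Fin 3)) k‖ ≤
          Cw * sobolevWeight (-((Fintype.card (Fin 3) : ℝ) + 3)) k)
        (hwfix : ∀ t ∈ Icc 0 T, ∀ k, lerayCLM k ((w t : (Fin 3 → ℤ) → EuclideanSpace ℂ (Fin 3)) k) =
          (w t : (Fin 3 → ℤ) → EuclideanSpace ℂ (Fin 3)) k)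
        (hwreal : ∀ t ∈ Icc 0 T, ∀ (j : Fin 3) (k : Fin 3 → ℤ),
          (EuclideanSpace.proj j : EuclideanSpace ℂ (Fin 3) →L[ℂ] ℂ) ((w t : (Fin 3 → ℤ) → EuclideanSpace ℂ (Fin 3)) (-k)) =
            conj ((EuclideanSpace.proj j : EuclideanSpace ℂ (Fin 3) →L[ℂ] ℂ) ((w t : (Fin 3 → ℤ) → EuclideanSpace ℂ (Fin 3)) k)))
        (hwdiv : ∀ t ∈ Icc 0 T, ∀ k : Fin 3 → ℤ,
          ∑ j, ((k j : ℤ) : ℂ) * (EuclideanSpace.proj j : EuclideanSpace ℂ (Fin 3) →L[ℂ] ℂ)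
            ((w t : (Fin 3 → ℤ) → EuclideanSpace ℂ (Fin 3)) k) = 0)
        {t : ℝ} (ht : t ∈ Icc 0 T) (hχ : ε * Real.exp (μ * t) ≤ 2 / (9 * C')),
        ε * Real.exp (μ * t) / 2 ≤ ‖w t‖ := by
  obtain ⟨v, hv1, hvr, hvP, hvreal, hvdiv, hAv, hres⟩ := exists_eigenData_of_isLinNSEigenvalue_abc A B C heig
  refine ⟨v, hv1, hvr, hvP, hvreal, hvdiv, hAv, ?_⟩
  intro T hT ε hε u sol_continuousOn sol_init sol_hasDerivWithinAt sol_derivCont sol_proj sol_fix sol_real sol_div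
    μt G₁ G₂ G hG₁ hG₂ hG hG₁P hG₂P hGP hG₁pos ω c m₂ M₁ hc hm₂ hM₁ hm₂' hM₁' m M ω₁ hm0 hm hM h₁ h₂ hL hμ₁ hμ₂
    htail hgap C' hCC' hsmall w hw hw0 hw' Cw hCw hwdec hwfix hwreal hwdiv t ht hχ
  exact half_prediction_nsField_of_levels K hν (rapidDecay_abcHost A B C) (abcHost_real A B C)
    (abcHost_div A B C) norm_proj_le isSelfAdjoint_lerayCLM norm_lerayCLM_le
    (tsum_sobolevWeight_neg_two_sq_lt_top (Fintype.card_fin 3).le) hT hv1 hvr hvP hvreal hvdiv hμ hε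
    sol_continuousOn sol_init sol_hasDerivWithinAt sol_derivCont sol_proj sol_fix sol_real sol_div hG₁ hG₂ hG hG₁P
    hG₂P hGP hG₁pos hc hm₂ hM₁ hm₂' hM₁' hm0 hm hM h₁ h₂ hL hμ₁ hμ₂ htail hgap
    (hres.comp (tendsto_add_atTop_nat K)) hCC' hsmall hw hw0 hw' hCw hwdec hwfix hwreal hwdiv ht hχ

end Summit.NavierStokesRegularity.FluidComputer.TransportGalerkinAbcH2

end
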